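import Literature.MathematicalPhysics.QuantumFieldTheory.Balaban1983to89.Beta.PolarizationSign

/-!
# `BalabanUV.Gaps.D1SymmetryPencil` — cell pub-balaban-gaps, row (D1), seat g1-p1: THE END's TWO SYMMETRY BINDERS ARE LINEAR — along an entrywise affine pencil of kernels `c ↦ P 0 + c·U` the
# printed Ward identity (5.9) and reflection covariance (5.7) hold at NO, ONE, or EVERY parameter; uniqueness needs only that the SLOPE `U` itself breaks the symmetry (no moments, no
# summability); existence is PROPORTIONALITY OF DEFECTS (parameter-free 2×2 minors); both binders, or one binder at several levels, for ONE parameter = cross minors plus one ratio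

HONEST FRAMING (cell rule, page 1 of everything): [folklore] real linear algebra, generic over `B12Beta.Kernel d`; the printed properties (5.9) ∕ (5.7)–(5.8) [Balaban1987RG1 p. 293] enter only as the
tree's PREDICATES `PolarizationSign.WardTransversal ∕ AxisReflectionCovariant` on abstract kernels.  The consumer is the companion file `Gaps/D1BorderPencilSymmetry` (the β-lead's pinned family
`JsBalAn1(r; c⃗; cE₂; cB; T)` and the b2b wall's (III′) literal, whose step kernels GEN 15 proved AFFINE IN THE BORDER WEIGHT `cB` entrywise).  Nothing of Bałaban's asserted; NO coefficient
computed or signed; (D1) NOT discharged; 0∕4 row-D1 binders; NOT `BetaPertH`, NOT continuum, NOT Clay.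
HONEST DEPENDENCY (b2b cell, verbatim): «continuum YM on T⁴ ⇐ BetaPertH ∧ nine spine estimates (0/9 proved); BetaPertH ⇐ (D1) ∧ (D4) ∧ CAP+tail; G-an2-4 gates asym, D1 and NE2/3/4.»

CONTENT (all [folklore]; two bookkeeping `def`s — the WARD DEFECT `wardDefect P ν z := Σ_μ (P_{μν}(z − e_μ) − P_{μν}(z))` and the REFLECTION DEFECT `reflDefect P α μ ν z` of a kernel, so that
`WardTransversal P ↔ ∀ ν z, wardDefect P ν z = 0` (`wardTransversal_iff`, `Iff.rfl`) and `AxisReflectionCovariant P ↔ ∀ α μ ν z, reflDefect P α μ ν z = 0` (`axisReflectionCovariant_iff`); 0 sorry):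
§1 real affine systems `f₀ + c·g = 0` over an index type: two roots ⟹ `g = f₀ = 0` ⟹ every `c` is a root (`affine_pair`, `affine_all_of_pair`); **TRICHOTOMY** none ∕ one ∕ all (`affine_trichotomy`);
uniqueness from ONE nonzero `g i` (`affine_unique`), the root `c = −f₀ i₀ ∕ g i₀` (`affine_formula`); the `c`-FREE minors `f₀ i · g i′ = f₀ i′ · g i` (`affine_minor`) and **SOLVABILITY ⟺ minors
against a pivot** (`affine_exists_iff`); two systems sharing `c` (`affine_joint_minor`, `affine_joint_exists_iff`); two parameters `f₀ + c·g + s·h = 0`: Cramer uniqueness ∕ formula under a nonzero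
2×2 determinant (`affine₂_unique`, `affine₂_formula`), the dependent case `h = κ·g` (`affine₂_line`: only `c + κ·s` is pinned).
§2 `wardDefect`, `reflDefect`, `wardTransversal_iff`, `axisReflectionCovariant_iff`; both defects are AFFINE along an entrywise affine pencil (`wardDefect_pencil`, `reflDefect_pencil`,
`wardTransversal_pencil_iff`, `axisReflectionCovariant_pencil_iff`); for `c ↦ P c = P 0 + c·U`: **`ward_pencil_trichotomy`** (the Ward-transversal members are none, one, or all),
`ward_pencil_all_of_pair`, **`ward_pencil_unique`** (`U` NOT Ward-transversal ⟹ at most one member is), `ward_pencil_formula` (ratio of defects at ONE entry), `ward_pencil_minor`,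
**`ward_pencil_exists_iff`**; the same five for the reflection binder (`refl_pencil_*`); **`ward_refl_pencil_minor`** ∕ **`ward_refl_pencil_exists_iff`** (ONE `c` with BOTH symmetries ⟺ Ward
minors ∧ Ward–reflection cross minors, all `c`-free, given one nonzero Ward defect of `U`); §3 a family of pencils `P j c = P j 0 + c·U j` sharing the parameter (the levels):
`wardTransversal_levels_iff`, **`ward_levels_minor`**, **`ward_levels_exists_iff`**; two-parameter pencils `P c s = P 0 0 + c·U + s·V`: `wardDefect_pencil₂`, **`ward_pencil₂_unique`** (Cramer),
`ward_pencil₂_formula`, `ward_pencil₂_line`; §4 SHARPNESS — each branch of the trichotomy occurs (explicit pencils on `ℤ⁴`: `wardDefect_massKernel_zero`, `not_wardTransversal_massKernel` — the unit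
diagonal mass kernel `[μ = ν][z = 0]` has Ward defect `−1` at `(0, 0)` —, `exists_pencil_none`, `exists_pencil_unique`, `exists_pencil_all`).

Provenance: cell pub-balaban-gaps, seat g1-p1 GEN 16 (prover-pub-balaban-gaps-g1-p1-g16-0), 2026-08-25; imports `Beta/PolarizationSign` ONLY (Literature, built); no existing file touched.
-/

noncomputable section

open Literature.MathematicalPhysics.QuantumFieldTheory Balaban1983to89 Balaban1983to89.Beta
open B6BondElimination (unitVec)
open PolarizationSign (WardTransversal AxisReflectionCovariant axisReflect reflSign)

namespace Summit.QuantumFields.BalabanUV.Gaps.D1SymmetryPencil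

/-! ## §1 Real affine systems over an index type -/
section Affine
variable {ι ι' : Type*} {f₀ g h : ι → ℝ} {f₀' g' : ι' → ℝ} {c c' s s' : ℝ}

/-- [folklore] Two different roots of the affine system `f₀ + c·g = 0` force slope and intercept to vanish identically. -/
theorem affine_pair (hc : ∀ i, f₀ i + c * g i = 0) (hc' : ∀ i, f₀ i + c' * g i = 0) (hne : c ≠ c') : (∀ i, g i = 0) ∧ ∀ i, f₀ i = 0 := by
  have hg : ∀ i, g i = 0 := fun i => by
    have h : (c - c') * g i = 0 := by linear_combination hc i - hc' i
    exact (mul_eq_zero.mp h).resolve_left (sub_ne_zero.mpr hne)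
  refine ⟨hg, fun i => ?_⟩
  have h := hc i
  rwa [hg i, mul_zero, add_zero] at h
/-- [folklore] … hence EVERY `c` is a root. -/
theorem affine_all_of_pair (hc : ∀ i, f₀ i + c * g i = 0) (hc' : ∀ i, f₀ i + c' * g i = 0) (hne : c ≠ c') (c'' : ℝ) (i : ι) : f₀ i + c'' * g i = 0 := by
  obtain ⟨hg, hf⟩ := affine_pair hc hc' hne
  rw [hg i, hf i, mul_zero, add_zero]
/-- [folklore] **TRICHOTOMY**: the roots of `f₀ + c·g = 0` are none, exactly one, or all of `ℝ` — stated as «at most one, or all». -/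
theorem affine_trichotomy (f₀ g : ι → ℝ) :
    (∀ c c' : ℝ, (∀ i, f₀ i + c * g i = 0) → (∀ i, f₀ i + c' * g i = 0) → c = c') ∨ ∀ (c : ℝ) (i : ι), f₀ i + c * g i = 0 := by
  by_cases H : ∃ c c' : ℝ, c ≠ c' ∧ (∀ i, f₀ i + c * g i = 0) ∧ ∀ i, f₀ i + c' * g i = 0
  · obtain ⟨c, c', hne, hc, hc'⟩ := H
    exact Or.inr (affine_all_of_pair hc hc' hne)
  · refine Or.inl fun c c' hc hc' => ?_
    by_contra hne
    exact H ⟨c, c', hne, hc, hc'⟩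
/-- [folklore] ONE nonzero slope entry makes the root unique. -/
theorem affine_unique (hg : ∃ i, g i ≠ 0) (hc : ∀ i, f₀ i + c * g i = 0) (hc' : ∀ i, f₀ i + c' * g i = 0) : c = c' := by
  obtain ⟨i, hi⟩ := hg
  by_contra hne
  exact hi ((affine_pair hc hc' hne).1 i)
/-- [folklore] … and gives it explicitly: `c = −f₀ i₀ ∕ g i₀`. -/
theorem affine_formula {i₀ : ι} (hg : g i₀ ≠ 0) (hc : ∀ i, f₀ i + c * g i = 0) : c = -f₀ i₀ / g i₀ := by
  have e := hc i₀
  field_simp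
  linarith
/-- [folklore] **THE `c`-FREE MINORS**: a root exists only if `(f₀, g)` has rank ≤ 1: `f₀ i · g i′ = f₀ i′ · g i` for all `i, i′`. -/
theorem affine_minor (hc : ∀ i, f₀ i + c * g i = 0) (i i' : ι) : f₀ i * g i' = f₀ i' * g i := by
  have h1 : f₀ i = -(c * g i) := by linarith [hc i]
  have h2 : f₀ i' = -(c * g i') := by linarith [hc i']
  rw [h1, h2]; ring
/-- [folklore] **SOLVABILITY ⟺ MINORS AGAINST A PIVOT** `i₀` with `g i₀ ≠ 0`. -/
theorem affine_exists_iff {i₀ : ι} (hg : g i₀ ≠ 0) : (∃ c : ℝ, ∀ i, f₀ i + c * g i = 0) ↔ ∀ i, f₀ i * g i₀ = f₀ i₀ * g i := by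
  constructor
  · rintro ⟨c, hc⟩ i
    exact affine_minor hc i i₀
  · intro H
    refine ⟨-f₀ i₀ / g i₀, fun i => ?_⟩
    have e : f₀ i + -f₀ i₀ / g i₀ * g i = (f₀ i * g i₀ - f₀ i₀ * g i) / g i₀ := by
      rw [eq_div_iff hg, add_mul, div_mul_eq_mul_div, div_mul_cancel₀ _ hg]; ring
    rw [e, sub_eq_zero.mpr (H i), zero_div]

/-- [folklore] TWO systems sharing the parameter: a common root forces the CROSS minors `f₀ i · g′ i′ = f₀′ i′ · g i`. -/
theorem affine_joint_minor (hc : ∀ i, f₀ i + c * g i = 0) (hc' : ∀ i', f₀' i' + c * g' i' = 0) (i : ι) (i' : ι') : f₀ i * g' i' = f₀' i' * g i := by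
  have h1 : f₀ i = -(c * g i) := by linarith [hc i]
  have h2 : f₀' i' = -(c * g' i') := by linarith [hc' i']
  rw [h1, h2]; ring
/-- [folklore] … and a common root EXISTS iff, against a pivot `i₀` of the first system, its own minors and the cross minors vanish. -/
theorem affine_joint_exists_iff {i₀ : ι} (hg : g i₀ ≠ 0) :
    (∃ c : ℝ, (∀ i, f₀ i + c * g i = 0) ∧ ∀ i', f₀' i' + c * g' i' = 0) ↔
      (∀ i, f₀ i * g i₀ = f₀ i₀ * g i) ∧ ∀ i', f₀' i' * g i₀ = f₀ i₀ * g' i' := by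
  constructor
  · rintro ⟨c, hc, hc'⟩
    exact ⟨fun i => affine_minor hc i i₀, fun i' => (affine_joint_minor hc hc' i₀ i').symm⟩
  · rintro ⟨H, H'⟩
    refine ⟨-f₀ i₀ / g i₀, fun i => ?_, fun i' => ?_⟩
    · have e : f₀ i + -f₀ i₀ / g i₀ * g i = (f₀ i * g i₀ - f₀ i₀ * g i) / g i₀ := by
        rw [eq_div_iff hg, add_mul, div_mul_eq_mul_div, div_mul_cancel₀ _ hg]; ring
      rw [e, sub_eq_zero.mpr (H i), zero_div]
    · have e : f₀' i' + -f₀ i₀ / g i₀ * g' i' = (f₀' i' * g i₀ - f₀ i₀ * g' i') / g i₀ := by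
        rw [eq_div_iff hg, add_mul, div_mul_eq_mul_div, div_mul_cancel₀ _ hg]; ring
      rw [e, sub_eq_zero.mpr (H' i'), zero_div]
/-- [folklore] **TWO PARAMETERS, CRAMER UNIQUENESS**: for `f₀ + c·g + s·h = 0`, a nonzero 2×2 determinant of `(g, h)` at two indices makes the root `(c, s)` unique. -/
theorem affine₂_unique {i₁ i₂ : ι} (hdet : g i₁ * h i₂ - g i₂ * h i₁ ≠ 0) (hc : ∀ i, f₀ i + c * g i + s * h i = 0) (hc' : ∀ i, f₀ i + c' * g i + s' * h i = 0) :
    c = c' ∧ s = s' := by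
  have e1 : (c - c') * g i₁ + (s - s') * h i₁ = 0 := by linarith [hc i₁, hc' i₁]
  have e2 : (c - c') * g i₂ + (s - s') * h i₂ = 0 := by linarith [hc i₂, hc' i₂]
  have hc0 : (c - c') * (g i₁ * h i₂ - g i₂ * h i₁) = 0 := by linear_combination (h i₂) * e1 - (h i₁) * e2
  have hs0 : (s - s') * (g i₁ * h i₂ - g i₂ * h i₁) = 0 := by linear_combination (g i₁) * e2 - (g i₂) * e1
  exact ⟨sub_eq_zero.mp ((mul_eq_zero.mp hc0).resolve_right hdet), sub_eq_zero.mp ((mul_eq_zero.mp hs0).resolve_right hdet)⟩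

/-- [folklore] … with Cramer's formula. -/
theorem affine₂_formula {i₁ i₂ : ι} (hdet : g i₁ * h i₂ - g i₂ * h i₁ ≠ 0) (hc : ∀ i, f₀ i + c * g i + s * h i = 0) :
    c = (f₀ i₂ * h i₁ - f₀ i₁ * h i₂) / (g i₁ * h i₂ - g i₂ * h i₁) ∧ s = (f₀ i₁ * g i₂ - f₀ i₂ * g i₁) / (g i₁ * h i₂ - g i₂ * h i₁) := by
  rw [eq_div_iff hdet, eq_div_iff hdet]
  exact ⟨by linear_combination (h i₂) * hc i₁ - (h i₁) * hc i₂, by linear_combination (g i₁) * hc i₂ - (g i₂) * hc i₁⟩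

/-- [folklore] TWO PARAMETERS, DEPENDENT SLOPES `h = κ·g`: only the combination `c + κ·s` is pinned (by one nonzero `g i₀`). -/
theorem affine₂_line {κ : ℝ} (hκ : ∀ i, h i = κ * g i) {i₀ : ι} (hg : g i₀ ≠ 0) (hc : ∀ i, f₀ i + c * g i + s * h i = 0) : c + κ * s = -f₀ i₀ / g i₀ := by
  have e : f₀ i₀ + (c + κ * s) * g i₀ = 0 := by linear_combination hc i₀ - s * hκ i₀
  field_simp
  linarith

end Affine
/-! ## §2 The Ward and reflection DEFECTS of a kernel; affine pencils of kernels -/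
section Defects
variable {d : ℕ}

/-- [folklore] **THE WARD DEFECT** of a kernel: `wardDefect P ν z := Σ_μ (P_{μν}(z − e_μ) − P_{μν}(z))` — the left side of the printed Ward identity (5.9) as typed in `PolarizationSign.WardTransversal`
(Engine C's «first-index Ward divergence», up to the flip convention of `OneStepKernelFamily.wardTransversal_flipK_iff`).  Bookkeeping only. -/
def wardDefect (P : B12Beta.Kernel d) (ν : Fin d) (z : Fin d → ℤ) : ℝ := ∑ μ, (P μ ν (z - unitVec μ) - P μ ν z)

/-- [folklore] **THE REFLECTION DEFECT** of a kernel: `reflDefect P α μ ν z := P_{μν}(ε_α z − [μ=α]e_α + [ν=α]e_α) − ε_μ ε_ν P_{μν}(z)` — the difference of the two sides of the printed reflection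
covariance (5.7)–(5.8) as typed in `PolarizationSign.AxisReflectionCovariant`.  Bookkeeping only. -/
def reflDefect (P : B12Beta.Kernel d) (α μ ν : Fin d) (z : Fin d → ℤ) : ℝ :=
  P μ ν (axisReflect α z - (if μ = α then unitVec α else 0) + (if ν = α then unitVec α else 0)) - reflSign α μ * reflSign α ν * P μ ν z

/-- [folklore] `WardTransversal P` IS the vanishing of the Ward defect. -/
theorem wardTransversal_iff (P : B12Beta.Kernel d) : WardTransversal P ↔ ∀ ν z, wardDefect P ν z = 0 := Iff.rfl

/-- [folklore] `AxisReflectionCovariant P` IS the vanishing of the reflection defect. -/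
theorem axisReflectionCovariant_iff (P : B12Beta.Kernel d) : AxisReflectionCovariant P ↔ ∀ α μ ν z, reflDefect P α μ ν z = 0 := by
  simp only [PolarizationSign.AxisReflectionCovariant, reflDefect, sub_eq_zero]

/-- [folklore] The Ward defect is AFFINE along an entrywise affine pencil `P = P₀ + c·U`. -/
theorem wardDefect_pencil {P P₀ U : B12Beta.Kernel d} {c : ℝ} (hP : ∀ a b z, P a b z = P₀ a b z + c * U a b z) (ν : Fin d) (z : Fin d → ℤ) :
    wardDefect P ν z = wardDefect P₀ ν z + c * wardDefect U ν z := by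
  unfold wardDefect
  rw [Finset.mul_sum, ← Finset.sum_add_distrib]
  exact Finset.sum_congr rfl fun μ _ => by rw [hP, hP]; ring

/-- [folklore] The reflection defect is AFFINE along an entrywise affine pencil. -/
theorem reflDefect_pencil {P P₀ U : B12Beta.Kernel d} {c : ℝ} (hP : ∀ a b z, P a b z = P₀ a b z + c * U a b z) (α μ ν : Fin d) (z : Fin d → ℤ) :
    reflDefect P α μ ν z = reflDefect P₀ α μ ν z + c * reflDefect U α μ ν z := by
  unfold reflDefect
  rw [hP, hP]; ring

variable {P : ℝ → B12Beta.Kernel d} {U : B12Beta.Kernel d}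

/-- [folklore] Along a pencil `P c = P 0 + c·U`: `WardTransversal (P c)` is the affine system `wardDefect (P 0) + c · wardDefect U = 0` over the index `(ν, z)`. -/
theorem wardTransversal_pencil_iff (hP : ∀ c a b z, P c a b z = P 0 a b z + c * U a b z) (c : ℝ) :
    WardTransversal (P c) ↔ ∀ x : Fin d × (Fin d → ℤ), wardDefect (P 0) x.1 x.2 + c * wardDefect U x.1 x.2 = 0 := by
  rw [wardTransversal_iff]
  simp only [wardDefect_pencil (hP c), Prod.forall]

/-- [folklore] Along a pencil: `AxisReflectionCovariant (P c)` is the affine system `reflDefect (P 0) + c · reflDefect U = 0` over the index `(α, μ, ν, z)`. -/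
theorem axisReflectionCovariant_pencil_iff (hP : ∀ c a b z, P c a b z = P 0 a b z + c * U a b z) (c : ℝ) :
    AxisReflectionCovariant (P c) ↔ ∀ x : Fin d × Fin d × Fin d × (Fin d → ℤ), reflDefect (P 0) x.1 x.2.1 x.2.2.1 x.2.2.2 + c * reflDefect U x.1 x.2.1 x.2.2.1 x.2.2.2 = 0 := by
  rw [axisReflectionCovariant_iff]
  simp only [reflDefect_pencil (hP c), Prod.forall]

/-- [folklore] **WARD TRICHOTOMY ON A PENCIL**: the Ward-transversal members of `c ↦ P 0 + c·U` are none, exactly one, or all. -/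
theorem ward_pencil_trichotomy (hP : ∀ c a b z, P c a b z = P 0 a b z + c * U a b z) :
    (∀ c c' : ℝ, WardTransversal (P c) → WardTransversal (P c') → c = c') ∨ ∀ c : ℝ, WardTransversal (P c) := by
  rcases affine_trichotomy (fun x : Fin d × (Fin d → ℤ) => wardDefect (P 0) x.1 x.2) (fun x => wardDefect U x.1 x.2) with H | H
  · exact Or.inl fun c c' hc hc' => H c c' ((wardTransversal_pencil_iff hP c).1 hc) ((wardTransversal_pencil_iff hP c').1 hc')
  · exact Or.inr fun c => (wardTransversal_pencil_iff hP c).2 (H c)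

/-- [folklore] Two different Ward-transversal members ⟹ the slope `U` and EVERY member are Ward-transversal. -/
theorem ward_pencil_all_of_pair (hP : ∀ c a b z, P c a b z = P 0 a b z + c * U a b z) {c c' : ℝ} (hc : WardTransversal (P c)) (hc' : WardTransversal (P c'))
    (hne : c ≠ c') : WardTransversal U ∧ ∀ c'' : ℝ, WardTransversal (P c'') := by
  have h2 := affine_pair ((wardTransversal_pencil_iff hP c).1 hc) ((wardTransversal_pencil_iff hP c').1 hc') hne
  refine ⟨(wardTransversal_iff U).2 fun ν z => h2.1 (ν, z), fun c'' => (wardTransversal_pencil_iff hP c'').2 fun x => ?_⟩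
  rw [h2.1 x, h2.2 x, mul_zero, add_zero]

/-- [folklore] **UNIQUENESS FROM THE SLOPE ALONE**: if `U` is NOT Ward-transversal, at most ONE member of the pencil is (no moments, no summability). -/
theorem ward_pencil_unique (hP : ∀ c a b z, P c a b z = P 0 a b z + c * U a b z) (hU : ¬ WardTransversal U) {c c' : ℝ} (hc : WardTransversal (P c))
    (hc' : WardTransversal (P c')) : c = c' := by
  by_contra hne
  exact hU (ward_pencil_all_of_pair hP hc hc' hne).1

/-- [folklore] … and the member is `c = −wardDefect (P 0) ν₀ z₀ ∕ wardDefect U ν₀ z₀` at ANY entry where the slope's defect is nonzero. -/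
theorem ward_pencil_formula (hP : ∀ c a b z, P c a b z = P 0 a b z + c * U a b z) {ν₀ : Fin d} {z₀ : Fin d → ℤ} (hU : wardDefect U ν₀ z₀ ≠ 0) {c : ℝ}
    (hc : WardTransversal (P c)) : c = -wardDefect (P 0) ν₀ z₀ / wardDefect U ν₀ z₀ :=
  affine_formula (f₀ := fun x : Fin d × (Fin d → ℤ) => wardDefect (P 0) x.1 x.2) (g := fun x => wardDefect U x.1 x.2) (i₀ := (ν₀, z₀)) hU
    ((wardTransversal_pencil_iff hP c).1 hc)

/-- [folklore] **THE `c`-FREE NECESSARY CONDITION**: a Ward-transversal member exists only if the defects of `P 0` and `U` are PROPORTIONAL — all 2×2 minors vanish. -/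
theorem ward_pencil_minor (hP : ∀ c a b z, P c a b z = P 0 a b z + c * U a b z) {c : ℝ} (hc : WardTransversal (P c)) (ν : Fin d) (z : Fin d → ℤ) (ν' : Fin d)
    (z' : Fin d → ℤ) : wardDefect (P 0) ν z * wardDefect U ν' z' = wardDefect (P 0) ν' z' * wardDefect U ν z :=
  affine_minor (f₀ := fun x : Fin d × (Fin d → ℤ) => wardDefect (P 0) x.1 x.2) (g := fun x => wardDefect U x.1 x.2) ((wardTransversal_pencil_iff hP c).1 hc) (ν, z) (ν', z')

/-- [folklore] **SOLVABILITY**: given ONE entry `(ν₀, z₀)` where `U`'s Ward defect is nonzero, SOME member of the pencil is Ward-transversal iff the minors against that pivot vanish. -/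
theorem ward_pencil_exists_iff (hP : ∀ c a b z, P c a b z = P 0 a b z + c * U a b z) {ν₀ : Fin d} {z₀ : Fin d → ℤ} (hU : wardDefect U ν₀ z₀ ≠ 0) :
    (∃ c : ℝ, WardTransversal (P c)) ↔ ∀ ν z, wardDefect (P 0) ν z * wardDefect U ν₀ z₀ = wardDefect (P 0) ν₀ z₀ * wardDefect U ν z := by
  have h := affine_exists_iff (f₀ := fun x : Fin d × (Fin d → ℤ) => wardDefect (P 0) x.1 x.2) (g := fun x => wardDefect U x.1 x.2) (i₀ := (ν₀, z₀)) hU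
  simp only [Prod.forall] at h
  rw [← h]
  exact exists_congr fun c => (wardTransversal_pencil_iff hP c).trans (by simp only [Prod.forall])

/-- [folklore] REFLECTION TRICHOTOMY ON A PENCIL. -/
theorem refl_pencil_trichotomy (hP : ∀ c a b z, P c a b z = P 0 a b z + c * U a b z) :
    (∀ c c' : ℝ, AxisReflectionCovariant (P c) → AxisReflectionCovariant (P c') → c = c') ∨ ∀ c : ℝ, AxisReflectionCovariant (P c) := by
  rcases affine_trichotomy (fun x : Fin d × Fin d × Fin d × (Fin d → ℤ) => reflDefect (P 0) x.1 x.2.1 x.2.2.1 x.2.2.2)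
    (fun x => reflDefect U x.1 x.2.1 x.2.2.1 x.2.2.2) with H | H
  · exact Or.inl fun c c' hc hc' => H c c' ((axisReflectionCovariant_pencil_iff hP c).1 hc) ((axisReflectionCovariant_pencil_iff hP c').1 hc')
  · exact Or.inr fun c => (axisReflectionCovariant_pencil_iff hP c).2 (H c)

/-- [folklore] Two different reflection-covariant members ⟹ the slope and every member are reflection-covariant. -/
theorem refl_pencil_all_of_pair (hP : ∀ c a b z, P c a b z = P 0 a b z + c * U a b z) {c c' : ℝ} (hc : AxisReflectionCovariant (P c))
    (hc' : AxisReflectionCovariant (P c')) (hne : c ≠ c') : AxisReflectionCovariant U ∧ ∀ c'' : ℝ, AxisReflectionCovariant (P c'') := by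
  have h2 := affine_pair ((axisReflectionCovariant_pencil_iff hP c).1 hc) ((axisReflectionCovariant_pencil_iff hP c').1 hc') hne
  refine ⟨(axisReflectionCovariant_iff U).2 fun α μ ν z => h2.1 (α, μ, ν, z), fun c'' => (axisReflectionCovariant_pencil_iff hP c'').2 fun x => ?_⟩
  rw [h2.1 x, h2.2 x, mul_zero, add_zero]

/-- [folklore] **UNIQUENESS FROM THE SLOPE ALONE** (reflection): `U` NOT reflection-covariant ⟹ at most one member is. -/
theorem refl_pencil_unique (hP : ∀ c a b z, P c a b z = P 0 a b z + c * U a b z) (hU : ¬ AxisReflectionCovariant U) {c c' : ℝ} (hc : AxisReflectionCovariant (P c))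
    (hc' : AxisReflectionCovariant (P c')) : c = c' := by
  by_contra hne
  exact hU (refl_pencil_all_of_pair hP hc hc' hne).1

/-- [folklore] … with the explicit value at any entry where the slope's reflection defect is nonzero. -/
theorem refl_pencil_formula (hP : ∀ c a b z, P c a b z = P 0 a b z + c * U a b z) {α₀ μ₀ ν₀ : Fin d} {z₀ : Fin d → ℤ} (hU : reflDefect U α₀ μ₀ ν₀ z₀ ≠ 0) {c : ℝ}
    (hc : AxisReflectionCovariant (P c)) : c = -reflDefect (P 0) α₀ μ₀ ν₀ z₀ / reflDefect U α₀ μ₀ ν₀ z₀ :=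
  affine_formula (f₀ := fun x : Fin d × Fin d × Fin d × (Fin d → ℤ) => reflDefect (P 0) x.1 x.2.1 x.2.2.1 x.2.2.2) (g := fun x => reflDefect U x.1 x.2.1 x.2.2.1 x.2.2.2)
    (i₀ := (α₀, μ₀, ν₀, z₀)) hU ((axisReflectionCovariant_pencil_iff hP c).1 hc)

/-- [folklore] The `c`-free reflection minors. -/
theorem refl_pencil_minor (hP : ∀ c a b z, P c a b z = P 0 a b z + c * U a b z) {c : ℝ} (hc : AxisReflectionCovariant (P c)) (α μ ν : Fin d) (z : Fin d → ℤ)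
    (α' μ' ν' : Fin d) (z' : Fin d → ℤ) : reflDefect (P 0) α μ ν z * reflDefect U α' μ' ν' z' = reflDefect (P 0) α' μ' ν' z' * reflDefect U α μ ν z :=
  affine_minor (f₀ := fun x : Fin d × Fin d × Fin d × (Fin d → ℤ) => reflDefect (P 0) x.1 x.2.1 x.2.2.1 x.2.2.2) (g := fun x => reflDefect U x.1 x.2.1 x.2.2.1 x.2.2.2)
    ((axisReflectionCovariant_pencil_iff hP c).1 hc) (α, μ, ν, z) (α', μ', ν', z')

/-- [folklore] Reflection solvability against a pivot. -/
theorem refl_pencil_exists_iff (hP : ∀ c a b z, P c a b z = P 0 a b z + c * U a b z) {α₀ μ₀ ν₀ : Fin d} {z₀ : Fin d → ℤ} (hU : reflDefect U α₀ μ₀ ν₀ z₀ ≠ 0) :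
    (∃ c : ℝ, AxisReflectionCovariant (P c)) ↔
      ∀ α μ ν z, reflDefect (P 0) α μ ν z * reflDefect U α₀ μ₀ ν₀ z₀ = reflDefect (P 0) α₀ μ₀ ν₀ z₀ * reflDefect U α μ ν z := by
  have h := affine_exists_iff (f₀ := fun x : Fin d × Fin d × Fin d × (Fin d → ℤ) => reflDefect (P 0) x.1 x.2.1 x.2.2.1 x.2.2.2)
    (g := fun x => reflDefect U x.1 x.2.1 x.2.2.1 x.2.2.2) (i₀ := (α₀, μ₀, ν₀, z₀)) hU
  simp only [Prod.forall] at h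
  rw [← h]
  exact exists_congr fun c => (axisReflectionCovariant_pencil_iff hP c).trans (by simp only [Prod.forall])

/-- [folklore] **BOTH BINDERS FOR ONE MEMBER ⟹ `c`-FREE CROSS MINORS** between the Ward defects and the reflection defects of `P 0` and `U`. -/
theorem ward_refl_pencil_minor (hP : ∀ c a b z, P c a b z = P 0 a b z + c * U a b z) {c : ℝ} (hW : WardTransversal (P c)) (hR : AxisReflectionCovariant (P c)) (ν : Fin d)
    (z : Fin d → ℤ) (α μ' ν' : Fin d) (z' : Fin d → ℤ) : wardDefect (P 0) ν z * reflDefect U α μ' ν' z' = reflDefect (P 0) α μ' ν' z' * wardDefect U ν z :=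
  affine_joint_minor (f₀ := fun x : Fin d × (Fin d → ℤ) => wardDefect (P 0) x.1 x.2) (g := fun x => wardDefect U x.1 x.2)
    (f₀' := fun x : Fin d × Fin d × Fin d × (Fin d → ℤ) => reflDefect (P 0) x.1 x.2.1 x.2.2.1 x.2.2.2) (g' := fun x => reflDefect U x.1 x.2.1 x.2.2.1 x.2.2.2)
    ((wardTransversal_pencil_iff hP c).1 hW) ((axisReflectionCovariant_pencil_iff hP c).1 hR) (ν, z) (α, μ', ν', z')

/-- [folklore] **ONE MEMBER WITH BOTH SYMMETRIES EXISTS ⟺ Ward minors ∧ Ward–reflection cross minors** (all `c`-free), given one nonzero Ward defect of the slope. -/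
theorem ward_refl_pencil_exists_iff (hP : ∀ c a b z, P c a b z = P 0 a b z + c * U a b z) {ν₀ : Fin d} {z₀ : Fin d → ℤ} (hU : wardDefect U ν₀ z₀ ≠ 0) :
    (∃ c : ℝ, WardTransversal (P c) ∧ AxisReflectionCovariant (P c)) ↔
      (∀ ν z, wardDefect (P 0) ν z * wardDefect U ν₀ z₀ = wardDefect (P 0) ν₀ z₀ * wardDefect U ν z) ∧
        ∀ α μ ν z, reflDefect (P 0) α μ ν z * wardDefect U ν₀ z₀ = wardDefect (P 0) ν₀ z₀ * reflDefect U α μ ν z := by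
  have h := affine_joint_exists_iff (f₀ := fun x : Fin d × (Fin d → ℤ) => wardDefect (P 0) x.1 x.2) (g := fun x => wardDefect U x.1 x.2)
    (f₀' := fun x : Fin d × Fin d × Fin d × (Fin d → ℤ) => reflDefect (P 0) x.1 x.2.1 x.2.2.1 x.2.2.2) (g' := fun x => reflDefect U x.1 x.2.1 x.2.2.1 x.2.2.2)
    (i₀ := (ν₀, z₀)) hU
  simp only [Prod.forall] at h
  rw [← h]
  exact exists_congr fun c => and_congr ((wardTransversal_pencil_iff hP c).trans (by simp only [Prod.forall]))
    ((axisReflectionCovariant_pencil_iff hP c).trans (by simp only [Prod.forall]))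

end Defects
/-! ## §3 A family of pencils sharing the parameter (the levels `j`); two-parameter pencils -/
section Levels
variable {d : ℕ} {P : ℕ → ℝ → B12Beta.Kernel d} {U : ℕ → B12Beta.Kernel d}

/-- [folklore] Along a family of pencils `P j c = P j 0 + c·U j`: Ward transversality at EVERY level is one affine system over the index `(j, ν, z)`. -/
theorem wardTransversal_levels_iff (hP : ∀ j c a b z, P j c a b z = P j 0 a b z + c * U j a b z) (c : ℝ) :
    (∀ j, WardTransversal (P j c)) ↔ ∀ x : ℕ × Fin d × (Fin d → ℤ), wardDefect (P x.1 0) x.2.1 x.2.2 + c * wardDefect (U x.1) x.2.1 x.2.2 = 0 := by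
  simp only [wardTransversal_iff, Prod.forall]
  exact forall_congr' fun j => by simp only [wardDefect_pencil (hP j c)]

/-- [folklore] **ONE PARAMETER FOR ALL LEVELS ⟹ CROSS-LEVEL MINORS** (`c`-free): `wardDefect (P j 0) ν z · wardDefect (U j′) ν′ z′ = wardDefect (P j′ 0) ν′ z′ · wardDefect (U j) ν z`. -/
theorem ward_levels_minor (hP : ∀ j c a b z, P j c a b z = P j 0 a b z + c * U j a b z) {c : ℝ} (hc : ∀ j, WardTransversal (P j c)) (j : ℕ) (ν : Fin d) (z : Fin d → ℤ)
    (j' : ℕ) (ν' : Fin d) (z' : Fin d → ℤ) : wardDefect (P j 0) ν z * wardDefect (U j') ν' z' = wardDefect (P j' 0) ν' z' * wardDefect (U j) ν z :=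
  affine_minor (f₀ := fun x : ℕ × Fin d × (Fin d → ℤ) => wardDefect (P x.1 0) x.2.1 x.2.2) (g := fun x => wardDefect (U x.1) x.2.1 x.2.2) ((wardTransversal_levels_iff hP c).1 hc)
    (j, ν, z) (j', ν', z')

/-- [folklore] **SOLVABILITY AT ALL LEVELS AT ONCE** ⟺ the cross-level minors against one pivot `(j₀, ν₀, z₀)` with `wardDefect (U j₀) ν₀ z₀ ≠ 0`. -/
theorem ward_levels_exists_iff (hP : ∀ j c a b z, P j c a b z = P j 0 a b z + c * U j a b z) {j₀ : ℕ} {ν₀ : Fin d} {z₀ : Fin d → ℤ} (hU : wardDefect (U j₀) ν₀ z₀ ≠ 0) :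
    (∃ c : ℝ, ∀ j, WardTransversal (P j c)) ↔ ∀ j ν z, wardDefect (P j 0) ν z * wardDefect (U j₀) ν₀ z₀ = wardDefect (P j₀ 0) ν₀ z₀ * wardDefect (U j) ν z := by
  have h := affine_exists_iff (f₀ := fun x : ℕ × Fin d × (Fin d → ℤ) => wardDefect (P x.1 0) x.2.1 x.2.2) (g := fun x => wardDefect (U x.1) x.2.1 x.2.2) (i₀ := (j₀, ν₀, z₀)) hU
  simp only [Prod.forall] at h
  rw [← h]
  exact exists_congr fun c => (wardTransversal_levels_iff hP c).trans (by simp only [Prod.forall])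

end Levels

section TwoParam
variable {d : ℕ} {P : ℝ → ℝ → B12Beta.Kernel d} {U V : B12Beta.Kernel d}

/-- [folklore] Along a two-parameter pencil `P c s = P 0 0 + c·U + s·V` the Ward defect is affine in `(c, s)`. -/
theorem wardDefect_pencil₂ (hP : ∀ c s a b z, P c s a b z = P 0 0 a b z + c * U a b z + s * V a b z) (c s : ℝ) (ν : Fin d) (z : Fin d → ℤ) :
    wardDefect (P c s) ν z = wardDefect (P 0 0) ν z + c * wardDefect U ν z + s * wardDefect V ν z := by
  unfold wardDefect
  rw [Finset.mul_sum, Finset.mul_sum, ← Finset.sum_add_distrib, ← Finset.sum_add_distrib]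
  exact Finset.sum_congr rfl fun μ _ => by rw [hP c s μ ν (z - unitVec μ), hP c s μ ν z]; ring

/-- [folklore] **TWO-PARAMETER WARD UNIQUENESS (Cramer)**: if the Ward defects of `U` and `V` have a nonzero 2×2 determinant at two entries, at most ONE `(c, s)` is Ward-transversal. -/
theorem ward_pencil₂_unique (hP : ∀ c s a b z, P c s a b z = P 0 0 a b z + c * U a b z + s * V a b z) {ν₁ : Fin d} {z₁ : Fin d → ℤ} {ν₂ : Fin d} {z₂ : Fin d → ℤ}
    (hdet : wardDefect U ν₁ z₁ * wardDefect V ν₂ z₂ - wardDefect U ν₂ z₂ * wardDefect V ν₁ z₁ ≠ 0) {c s c' s' : ℝ} (h : WardTransversal (P c s))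
    (h' : WardTransversal (P c' s')) : c = c' ∧ s = s' :=
  affine₂_unique (f₀ := fun x : Fin d × (Fin d → ℤ) => wardDefect (P 0 0) x.1 x.2) (g := fun x => wardDefect U x.1 x.2) (h := fun x => wardDefect V x.1 x.2)
    (i₁ := (ν₁, z₁)) (i₂ := (ν₂, z₂)) hdet (fun x => by rw [← wardDefect_pencil₂ hP]; exact h x.1 x.2) (fun x => by rw [← wardDefect_pencil₂ hP]; exact h' x.1 x.2)

/-- [folklore] … with Cramer's formula for the unique pair. -/
theorem ward_pencil₂_formula (hP : ∀ c s a b z, P c s a b z = P 0 0 a b z + c * U a b z + s * V a b z) {ν₁ : Fin d} {z₁ : Fin d → ℤ} {ν₂ : Fin d} {z₂ : Fin d → ℤ}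
    (hdet : wardDefect U ν₁ z₁ * wardDefect V ν₂ z₂ - wardDefect U ν₂ z₂ * wardDefect V ν₁ z₁ ≠ 0) {c s : ℝ} (h : WardTransversal (P c s)) :
    c = (wardDefect (P 0 0) ν₂ z₂ * wardDefect V ν₁ z₁ - wardDefect (P 0 0) ν₁ z₁ * wardDefect V ν₂ z₂) /
        (wardDefect U ν₁ z₁ * wardDefect V ν₂ z₂ - wardDefect U ν₂ z₂ * wardDefect V ν₁ z₁) ∧
      s = (wardDefect (P 0 0) ν₁ z₁ * wardDefect U ν₂ z₂ - wardDefect (P 0 0) ν₂ z₂ * wardDefect U ν₁ z₁) /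
        (wardDefect U ν₁ z₁ * wardDefect V ν₂ z₂ - wardDefect U ν₂ z₂ * wardDefect V ν₁ z₁) :=
  affine₂_formula (f₀ := fun x : Fin d × (Fin d → ℤ) => wardDefect (P 0 0) x.1 x.2) (g := fun x => wardDefect U x.1 x.2) (h := fun x => wardDefect V x.1 x.2)
    (i₁ := (ν₁, z₁)) (i₂ := (ν₂, z₂)) hdet (fun x => by rw [← wardDefect_pencil₂ hP]; exact h x.1 x.2)

/-- [folklore] TWO-PARAMETER, DEPENDENT DEFECTS `wardDefect V = κ · wardDefect U`: Ward transversality pins only `c + κ·s`. -/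
theorem ward_pencil₂_line (hP : ∀ c s a b z, P c s a b z = P 0 0 a b z + c * U a b z + s * V a b z) {κ : ℝ} (hκ : ∀ ν z, wardDefect V ν z = κ * wardDefect U ν z)
    {ν₀ : Fin d} {z₀ : Fin d → ℤ} (hU : wardDefect U ν₀ z₀ ≠ 0) {c s : ℝ} (h : WardTransversal (P c s)) : c + κ * s = -wardDefect (P 0 0) ν₀ z₀ / wardDefect U ν₀ z₀ :=
  affine₂_line (f₀ := fun x : Fin d × (Fin d → ℤ) => wardDefect (P 0 0) x.1 x.2) (g := fun x => wardDefect U x.1 x.2) (h := fun x => wardDefect V x.1 x.2)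
    (fun x => hκ x.1 x.2) (i₀ := (ν₀, z₀)) hU (fun x => by rw [← wardDefect_pencil₂ hP]; exact h x.1 x.2)

end TwoParam
/-! ## §4 Sharpness: each branch of the trichotomy occurs (explicit pencils on `ℤ⁴`; the unit diagonal mass kernel `[μ = ν][z = 0]` is not Ward-transversal) -/
section Sharpness
/-- [folklore] The unit diagonal mass kernel `A_μ A_μ` at zero momentum is NOT Ward-transversal: its Ward defect at `(ν, z) = (0, 0)` is `−1`. -/
theorem wardDefect_massKernel_zero : wardDefect (fun (μ ν : Fin 4) (z : Fin 4 → ℤ) => if μ = ν ∧ z = 0 then (1:ℝ) else 0) 0 0 = -1 := by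
  have hu : ∀ μ : Fin 4, (unitVec μ : Fin 4 → ℤ) ≠ 0 := fun μ h => by
    have h1 := congrFun h μ
    simp [B6BondElimination.unitVec] at h1
  unfold wardDefect
  rw [Fin.sum_univ_four]
  simp [hu]

/-- [folklore] … hence it is not Ward-transversal. -/
theorem not_wardTransversal_massKernel : ¬ WardTransversal (fun (μ ν : Fin 4) (z : Fin 4 → ℤ) => if μ = ν ∧ z = 0 then (1:ℝ) else 0) := fun h => by
  have h0 := (wardTransversal_iff _).1 h 0 0
  rw [wardDefect_massKernel_zero] at h0
  norm_num at h0

/-- [folklore] BRANCH «NONE»: the constant pencil at the mass kernel (slope `0`) has NO Ward-transversal member. -/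
theorem exists_pencil_none : ∃ (P : ℝ → B12Beta.Kernel 4) (U : B12Beta.Kernel 4), (∀ c a b z, P c a b z = P 0 a b z + c * U a b z) ∧ ∀ c, ¬ WardTransversal (P c) :=
  ⟨fun _ => fun μ ν z => if μ = ν ∧ z = 0 then (1:ℝ) else 0, fun _ _ _ => 0, fun c a b z => by simp only [mul_zero, add_zero], fun _ => not_wardTransversal_massKernel⟩

/-- [folklore] BRANCH «EXACTLY ONE»: the pencil `c ↦ c · (mass kernel)` is Ward-transversal exactly at `c = 0`. -/
theorem exists_pencil_unique : ∃ (P : ℝ → B12Beta.Kernel 4) (U : B12Beta.Kernel 4), (∀ c a b z, P c a b z = P 0 a b z + c * U a b z) ∧ ∀ c, WardTransversal (P c) ↔ c = 0 := by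
  refine ⟨fun c => fun μ ν z => c * (if μ = ν ∧ z = 0 then (1:ℝ) else 0), fun μ ν z => if μ = ν ∧ z = 0 then (1:ℝ) else 0, fun c a b z => by simp only [zero_mul, zero_add], fun c => ?_⟩
  have hP : ∀ a b z, (fun (μ ν : Fin 4) (z : Fin 4 → ℤ) => c * (if μ = ν ∧ z = 0 then (1:ℝ) else 0)) a b z =
      (fun (_ _ : Fin 4) (_ : Fin 4 → ℤ) => (0:ℝ)) a b z + c * (fun (μ ν : Fin 4) (z : Fin 4 → ℤ) => if μ = ν ∧ z = 0 then (1:ℝ) else 0) a b z := fun a b z => by simp only [zero_add]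
  have h0 : ∀ ν z, wardDefect (fun (_ _ : Fin 4) (_ : Fin 4 → ℤ) => (0:ℝ)) ν z = 0 := fun ν z => by simp [wardDefect]
  constructor
  · intro h
    have h1 := (wardTransversal_iff _).1 h 0 0
    rw [wardDefect_pencil hP, h0, wardDefect_massKernel_zero] at h1
    linarith
  · rintro rfl
    exact (wardTransversal_iff _).2 fun ν z => by rw [wardDefect_pencil hP, h0, zero_mul, add_zero]

/-- [folklore] BRANCH «ALL»: the zero pencil. -/
theorem exists_pencil_all : ∃ (P : ℝ → B12Beta.Kernel 4) (U : B12Beta.Kernel 4), (∀ c a b z, P c a b z = P 0 a b z + c * U a b z) ∧ ∀ c, WardTransversal (P c) :=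
  ⟨fun _ _ _ _ => 0, fun _ _ _ => 0, fun c a b z => by simp only [mul_zero, add_zero], fun _ => (wardTransversal_iff _).2 fun ν z => by simp [wardDefect]⟩

end Sharpness
/-- [folklore] The zero kernel has zero Ward defect (the slope of a constant pencil; CASE «all defects vanish» of the solvable-colour-set dichotomies). -/
theorem wardDefect_zero {d : ℕ} (ν : Fin d) (z : Fin d → ℤ) : wardDefect (fun (_ _ : Fin d) (_ : Fin d → ℤ) => (0:ℝ)) ν z = 0 := by simp [wardDefect]
/-- [folklore] The zero kernel has zero reflection defect. -/
theorem reflDefect_zero {d : ℕ} (α μ ν : Fin d) (z : Fin d → ℤ) : reflDefect (fun (_ _ : Fin d) (_ : Fin d → ℤ) => (0:ℝ)) α μ ν z = 0 := by simp [reflDefect]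

/-- [folklore] The Ward defect is ADDITIVE in the kernel (entrywise sum). -/
theorem wardDefect_add {d : ℕ} (P Q : B12Beta.Kernel d) (ν : Fin d) (z : Fin d → ℤ) :
    wardDefect (fun a b w => P a b w + Q a b w) ν z = wardDefect P ν z + wardDefect Q ν z := by
  unfold wardDefect; rw [← Finset.sum_add_distrib]; exact Finset.sum_congr rfl fun μ _ => by ring
/-- [folklore] The Ward defect is HOMOGENEOUS in the kernel (entrywise scalar multiple). -/
theorem wardDefect_smul {d : ℕ} (c : ℝ) (P : B12Beta.Kernel d) (ν : Fin d) (z : Fin d → ℤ) :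
    wardDefect (fun a b w => c * P a b w) ν z = c * wardDefect P ν z := by
  unfold wardDefect; rw [Finset.mul_sum]; exact Finset.sum_congr rfl fun μ _ => by ring
end Summit.QuantumFields.BalabanUV.Gaps.D1SymmetryPencil

end
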